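import Mathlib
import Literature.NumberTheory.Transcendental.KZGroundingRelations
import Summits.KontsevichZagierPeriods.KontsevichZagierPeriods.Theorems.InverseLandauTateFamilyKernelTameRelA

/-!
# `TateFamilyKernel` toolkit — tame certificates: a sum of Ayoub relations in more variables is a relation

Crux `TateFamilyKernel` (stmt-KontsevichZagierPeriods-9130, route `InverseLandau`), sequel of
`InverseLandauTateFamilyKernelTameRelA.lean`. The shape in which every certificate line delivers the
fibre `f = F(·,ϖ₀)` on `[0,1]ⁿ` is (card rational-cube-certificates, First lemma; Ayoub, EMS Newsl. 91
(2014) Def. 10; Kontsevich–Zagier 2001 §1.1 "introducing more variables"):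

  `f(z) = Σ_k ( ∂_{i_k} G_k − G_k|_{x_{i_k}=1} + G_k|_{x_{i_k}=0} )(w)`  for all `w ∈ [0,1]^{n+m}`,
  `z = ` the first `n` coordinates of `w`,

with TAME data `G_k` (analytic near the closed cube, `ℚ`-semialgebraic — e.g. rational in `w` with
coefficients in `ℚ(ϖ₀)`). This file proves that such an identity puts `[[0,1]ⁿ, f]` in `KZ.relations`:

* `tame_liftLast`, `tame_liftN` — ignoring the last `m` coordinates is a relation (iterated
  `tame_liftAt`);
* `tame_sum_relA_mem_relations` — a tame representation whose integrand is a finite sum of Ayoub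
  elements is a relation (integrand additivity `KZ.of_sub_sum_integrand_mem_relations` + `tame_relA_mem_relations`);
* `tame_certificate` — the two combined: the First lemma of the card for every `n`, `m`, `K`.

No named fact, no new definition.
-/

noncomputable section

open MeasureTheory Set
open Literature.NumberTheory.Transcendental
open Literature.ModelTheory.ExponentialFields (IsSemialgebraic)

namespace Summit.KontsevichZagierPeriods.InverseLandau.TateFamilyKernel

variable {n : ℕ}

/-! ### Ignoring the last coordinates -/

/-- Ignoring the LAST coordinate is a relation for tame data: `[[0,1]ⁿ⁺¹, u ∘ init] ≡ [[0,1]ⁿ, u]`.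
[cite: KontsevichZagier2001, §1.2 rule (3)] -/
theorem tame_liftLast {u : (Fin n → ℝ) → ℝ} (hua : AnalyticOnNhd ℝ u (KZ.cube n))
    (hus : IsSemialgebraicFunOn ℚ (KZ.cube n) u)
    (U : KZ.IntegralRep (n + 1)) (hU : U.IsTameCube)
    (hUi : ∀ w ∈ KZ.cube (n + 1), U.integrand w = u (Fin.init w))
    (u0 : KZ.IntegralRep n) (hu0 : u0.IsTameCube) (hu0i : ∀ x ∈ KZ.cube n, u0.integrand x = u x) :
    KZ.of U - KZ.of u0 ∈ KZ.relations :=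
  tame_liftAt (Fin.last n) hua hus U hU (fun w hw => by rw [hUi w hw, Fin.removeNth_last]) u0 hu0 hu0i

/-- Reading the first `n` coordinates of `w ∈ ℝ^{n+m+1}` through `init`. [folklore] -/
theorem init_comp_castAdd (m : ℕ) (w : Fin (n + m + 1) → ℝ) (j : Fin n) :
    Fin.init w (Fin.castAdd m j) = w (Fin.castAdd (m + 1) j) := by
  simp only [Fin.init]
  congr 1

/-- **Ignoring the last `m` coordinates is a relation for tame data**:
`[[0,1]^{n+m}, w ↦ u(w₁,…,wₙ)] ≡ [[0,1]ⁿ, u]`. [cite: KontsevichZagier2001, §1.2 rule (3)] -/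
theorem tame_liftN {u : (Fin n → ℝ) → ℝ} (hua : AnalyticOnNhd ℝ u (KZ.cube n))
    (hus : IsSemialgebraicFunOn ℚ (KZ.cube n) u) :
    ∀ (m : ℕ) (U : KZ.IntegralRep (n + m)), U.IsTameCube →
      (∀ w ∈ KZ.cube (n + m), U.integrand w = u (fun j => w (Fin.castAdd m j))) →
      ∀ (u0 : KZ.IntegralRep n), u0.IsTameCube → (∀ x ∈ KZ.cube n, u0.integrand x = u x) →
      KZ.of U - KZ.of u0 ∈ KZ.relations
  | 0, U, hU, hUi, u0, hu0, hu0i =>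
    KZ.of_sub_of_mem_relations_of_eqOn (by rw [hU.domain_eq, hu0.domain_eq]; rfl) fun w hw => by
      rw [hU.domain_eq] at hw
      rw [hUi w hw, hu0i w hw]
      exact congrArg u (funext fun j => congrArg w (Fin.ext rfl))
  | m + 1, U, hU, hUi, u0, hu0, hu0i => by
    -- the intermediate representation in `n + m` variables
    have hva : AnalyticOnNhd ℝ (fun v : Fin (n + m) → ℝ => u (fun j => v (Fin.castAdd m j)))
        (KZ.cube (n + m)) := by
      obtain ⟨L, hL⟩ : ∃ L : (Fin (n + m) → ℝ) →L[ℝ] (Fin n → ℝ), ∀ v, L v = fun j => v (Fin.castAdd m j) :=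
        ⟨ContinuousLinearMap.pi fun j => ContinuousLinearMap.proj (Fin.castAdd m j), fun v => by
          ext j; simp⟩
      intro v hv
      have hvz : (fun j => v (Fin.castAdd m j)) ∈ KZ.cube n := fun j => KZ.mem_cube.1 hv _
      have huL : AnalyticAt ℝ u (L v) := by rw [hL]; exact hua _ hvz
      exact (huL.comp (L.analyticAt v)).congr (Filter.Eventually.of_forall fun v' => by simp [hL])
    have hvs : IsSemialgebraicFunOn ℚ (KZ.cube (n + m))
        (fun v : Fin (n + m) → ℝ => u (fun j => v (Fin.castAdd m j))) :=
      IsSemialgebraicFunOn.comp_isSemialgebraicMapOn_holds hus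
        (IsSemialgebraicMapOn.of_forall KZ.isSemialgebraic_cube fun j =>
          isSemialgebraicFunOn_apply KZ.isSemialgebraic_cube (Fin.castAdd m j))
        fun v hv j => KZ.mem_cube.1 hv _
    set V : KZ.IntegralRep (n + m) := KZ.IntegralRep.tameCube _ hva hvs with hV
    have h1 : KZ.of U - KZ.of V ∈ KZ.relations :=
      tame_liftLast hva hvs U hU (fun w hw => by
        rw [hUi w hw]
        exact congrArg u (funext fun j => (init_comp_castAdd m w j).symm)) V
        (KZ.IntegralRep.isTameCube_tameCube _ _ _) (fun v _ => by simp [hV])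
    have h2 : KZ.of V - KZ.of u0 ∈ KZ.relations :=
      tame_liftN hua hus m V (KZ.IntegralRep.isTameCube_tameCube _ _ _) (fun v _ => by simp [hV])
        u0 hu0 hu0i
    have : KZ.of U - KZ.of u0 = (KZ.of U - KZ.of V) + (KZ.of V - KZ.of u0) := by abel
    rw [this]
    exact KZ.relations.add_mem h1 h2

/-! ### Finite sums of Ayoub elements -/

/-- **A finite sum of Ayoub elements with tame data is a relation.** For tame data `G_k, G'_k` on
`[0,1]^{N+1}` with `∂_{i_k} G_k = G'_k` on the cube, every tame representation whose integrand on the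
cube is `Σ_{k ∈ s} (G'_k w − G_k(w|_{i_k ↦ 1}) + G_k(w|_{i_k ↦ 0}))` lies in `KZ.relations`
(integrand additivity, then `tame_relA_mem_relations` termwise).
[cite: Ayoub2014, Def. 10] [cite: KontsevichZagier2001, §1.2] -/
theorem tame_sum_relA_mem_relations {N : ℕ} {ι : Type*} (s : Finset ι) (i : ι → Fin (N + 1))
    {G G' : ι → (Fin (N + 1) → ℝ) → ℝ}
    (hGa : ∀ k ∈ s, AnalyticOnNhd ℝ (G k) (KZ.cube (N + 1)))
    (hGs : ∀ k ∈ s, IsSemialgebraicFunOn ℚ (KZ.cube (N + 1)) (G k))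
    (hG'a : ∀ k ∈ s, AnalyticOnNhd ℝ (G' k) (KZ.cube (N + 1)))
    (hG's : ∀ k ∈ s, IsSemialgebraicFunOn ℚ (KZ.cube (N + 1)) (G' k))
    (hder : ∀ k ∈ s, ∀ w ∈ KZ.cube (N + 1),
      HasDerivAt (fun t : ℝ => G k (Function.update w (i k) t)) (G' k w) (w (i k)))
    (A : KZ.IntegralRep (N + 1)) (hA : A.IsTameCube)
    (hAi : ∀ w ∈ KZ.cube (N + 1), A.integrand w =
      ∑ k ∈ s, (G' k w - G k (Function.update w (i k) 1) + G k (Function.update w (i k) 0))) :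
    KZ.of A ∈ KZ.relations := by
  classical
  -- tame representations of the summands
  have hka : ∀ k ∈ s, AnalyticOnNhd ℝ
      (fun w => G' k w - G k (Function.update w (i k) 1) + G k (Function.update w (i k) 0))
      (KZ.cube (N + 1)) := by
    intro k hk w hw
    have h1 := analyticOnNhd_comp_removeNth (analyticOnNhd_comp_insertNth (hGa k hk) (i k)
      (c := 1) ⟨zero_le_one, le_rfl⟩) (i k) w hw
    have h0 := analyticOnNhd_comp_removeNth (analyticOnNhd_comp_insertNth (hGa k hk) (i k)
      (c := 0) ⟨le_rfl, zero_le_one⟩) (i k) w hw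
    simp only [Fin.insertNth_removeNth] at h1 h0
    exact ((hG'a k hk w hw).sub h1).add h0
  have hks : ∀ k ∈ s, IsSemialgebraicFunOn ℚ (KZ.cube (N + 1))
      (fun w => G' k w - G k (Function.update w (i k) 1) + G k (Function.update w (i k) 0)) := by
    intro k hk
    have h1c : ((1 : ℚ) : ℝ) ∈ Icc (0 : ℝ) 1 := by norm_num
    have h0c : ((0 : ℚ) : ℝ) ∈ Icc (0 : ℝ) 1 := by norm_num
    have h1 := isSemialgebraicFunOn_comp_removeNth (isSemialgebraicFunOn_comp_insertNth (hGs k hk) (i k)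
      (c := 1) h1c) (i k)
    have h0 := isSemialgebraicFunOn_comp_removeNth (isSemialgebraicFunOn_comp_insertNth (hGs k hk) (i k)
      (c := 0) h0c) (i k)
    simp only [Rat.cast_one, Rat.cast_zero, Fin.insertNth_removeNth] at h1 h0
    exact IsSemialgebraicFunOn.add_holds (IsSemialgebraicFunOn.sub_holds (hG's k hk) h1) h0
  -- choose them (junk off `s`)
  set R : ι → KZ.IntegralRep (N + 1) := fun k =>
    if hk : k ∈ s then KZ.IntegralRep.tameCube _ (hka k hk) (hks k hk) else A with hR
  have hRk : ∀ k (hk : k ∈ s), R k = KZ.IntegralRep.tameCube _ (hka k hk) (hks k hk) := fun k hk => by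
    simp only [hR, dif_pos hk]
  have hsum : KZ.of A - ∑ k ∈ s, KZ.of (R k) ∈ KZ.relations := by
    refine KZ.of_sub_sum_integrand_mem_relations s R A (fun k hk => ?_) fun w hw => ?_
    · rw [hRk k hk, KZ.IntegralRep.tameCube_domain, hA.domain_eq]
    · rw [hA.domain_eq] at hw
      rw [hAi w hw]
      refine Finset.sum_congr rfl fun k hk => ?_
      rw [hRk k hk, KZ.IntegralRep.tameCube_integrand]
  have hterm : ∀ k ∈ s, KZ.of (R k) ∈ KZ.relations := fun k hk => by
    rw [hRk k hk]
    exact tame_relA_mem_relations (i k) (hGa k hk) (hGs k hk) (hG'a k hk) (hG's k hk) (hder k hk)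
      _ (KZ.IntegralRep.isTameCube_tameCube _ _ _) (fun w _ => rfl)
  have hS : ∑ k ∈ s, KZ.of (R k) ∈ KZ.relations := KZ.relations.sum_mem fun k hk => hterm k hk
  have : KZ.of A = (KZ.of A - ∑ k ∈ s, KZ.of (R k)) + ∑ k ∈ s, KZ.of (R k) := by abel
  rw [this]
  exact KZ.relations.add_mem hsum hS

/-- `tame_sum_relA_mem_relations` in an arbitrary dimension `D` (for `D = 0` the index type `Fin 0`
is empty, so the sum is empty and the integrand vanishes). [cite: Ayoub2014, Def. 10] -/
theorem tame_sum_relA_mem_relations_dim {D : ℕ} {ι : Type*} (s : Finset ι) (i : ι → Fin D)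
    {G G' : ι → (Fin D → ℝ) → ℝ}
    (hGa : ∀ k ∈ s, AnalyticOnNhd ℝ (G k) (KZ.cube D))
    (hGs : ∀ k ∈ s, IsSemialgebraicFunOn ℚ (KZ.cube D) (G k))
    (hG'a : ∀ k ∈ s, AnalyticOnNhd ℝ (G' k) (KZ.cube D))
    (hG's : ∀ k ∈ s, IsSemialgebraicFunOn ℚ (KZ.cube D) (G' k))
    (hder : ∀ k ∈ s, ∀ w ∈ KZ.cube D,
      HasDerivAt (fun t : ℝ => G k (Function.update w (i k) t)) (G' k w) (w (i k)))
    (A : KZ.IntegralRep D) (hA : A.IsTameCube)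
    (hAi : ∀ w ∈ KZ.cube D, A.integrand w =
      ∑ k ∈ s, (G' k w - G k (Function.update w (i k) 1) + G k (Function.update w (i k) 0))) :
    KZ.of A ∈ KZ.relations := by
  cases D with
  | zero =>
    rcases s.eq_empty_or_nonempty with hs | ⟨k, hk⟩
    · subst hs
      refine KZ.of_mem_relations_of_eqOn_zero A fun w hw => ?_
      rw [hA.domain_eq] at hw
      simpa using hAi w hw
    · exact (i k).elim0
  | succ N => exact tame_sum_relA_mem_relations s i hGa hGs hG'a hG's hder A hA hAi

/-- **Tame certificates** (the First lemma of card rational-cube-certificates, for every `n`, `m`,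
`K`): if a tame `f` on `[0,1]ⁿ`, read on `[0,1]^{n+m}` through the first `n` coordinates, equals there a
finite sum of Ayoub elements `∂_{i_k}G_k − G_k|_{x_{i_k}=1} + G_k|_{x_{i_k}=0}` with tame data, then
every tame representation of `f` is a relation.
[cite: Ayoub2014, Def. 10] [cite: KontsevichZagier2001, §1.1–1.2] -/
theorem tame_certificate {m : ℕ} {ι : Type*} (s : Finset ι) (i : ι → Fin (n + m))
    {f : (Fin n → ℝ) → ℝ} (hfa : AnalyticOnNhd ℝ f (KZ.cube n)) (hfs : IsSemialgebraicFunOn ℚ (KZ.cube n) f)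
    {G G' : ι → (Fin (n + m) → ℝ) → ℝ}
    (hGa : ∀ k ∈ s, AnalyticOnNhd ℝ (G k) (KZ.cube (n + m)))
    (hGs : ∀ k ∈ s, IsSemialgebraicFunOn ℚ (KZ.cube (n + m)) (G k))
    (hG'a : ∀ k ∈ s, AnalyticOnNhd ℝ (G' k) (KZ.cube (n + m)))
    (hG's : ∀ k ∈ s, IsSemialgebraicFunOn ℚ (KZ.cube (n + m)) (G' k))
    (hder : ∀ k ∈ s, ∀ w ∈ KZ.cube (n + m),
      HasDerivAt (fun t : ℝ => G k (Function.update w (i k) t)) (G' k w) (w (i k)))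
    (hcert : ∀ w ∈ KZ.cube (n + m),
      f (fun j => w (Fin.castAdd m j)) =
        ∑ k ∈ s, (G' k w - G k (Function.update w (i k) 1) + G k (Function.update w (i k) 0)))
    (Φ : KZ.IntegralRep n) (hΦ : Φ.IsTameCube) (hΦi : ∀ z ∈ KZ.cube n, Φ.integrand z = f z) :
    KZ.of Φ ∈ KZ.relations := by
  -- `f` read in `n + m` variables, as a tame representation
  have hva : AnalyticOnNhd ℝ (fun w : Fin (n + m) → ℝ => f (fun j => w (Fin.castAdd m j))) (KZ.cube (n + m)) := by
    obtain ⟨L, hL⟩ : ∃ L : (Fin (n + m) → ℝ) →L[ℝ] (Fin n → ℝ), ∀ v, L v = fun j => v (Fin.castAdd m j) :=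
      ⟨ContinuousLinearMap.pi fun j => ContinuousLinearMap.proj (Fin.castAdd m j), fun v => by ext j; simp⟩
    intro v hv
    have hvz : (fun j => v (Fin.castAdd m j)) ∈ KZ.cube n := fun j => KZ.mem_cube.1 hv _
    have hfL : AnalyticAt ℝ f (L v) := by rw [hL]; exact hfa _ hvz
    exact (hfL.comp (L.analyticAt v)).congr (Filter.Eventually.of_forall fun v' => by simp [hL])
  have hvs : IsSemialgebraicFunOn ℚ (KZ.cube (n + m)) (fun w : Fin (n + m) → ℝ => f (fun j => w (Fin.castAdd m j))) :=
    IsSemialgebraicFunOn.comp_isSemialgebraicMapOn_holds hfs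
      (IsSemialgebraicMapOn.of_forall KZ.isSemialgebraic_cube fun j =>
        isSemialgebraicFunOn_apply KZ.isSemialgebraic_cube (Fin.castAdd m j))
      fun v hv j => KZ.mem_cube.1 hv _
  set A : KZ.IntegralRep (n + m) := KZ.IntegralRep.tameCube _ hva hvs with hAdef
  have hlift : KZ.of A - KZ.of Φ ∈ KZ.relations :=
    tame_liftN hfa hfs m A (KZ.IntegralRep.isTameCube_tameCube _ _ _) (fun w _ => by simp [hAdef]) Φ hΦ hΦi
  have hA : KZ.of A ∈ KZ.relations :=
    tame_sum_relA_mem_relations_dim s i hGa hGs hG'a hG's hder A (KZ.IntegralRep.isTameCube_tameCube _ _ _)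
      fun w hw => by simpa [hAdef] using hcert w hw
  have : KZ.of Φ = KZ.of A - (KZ.of A - KZ.of Φ) := by abel
  rw [this]
  exact KZ.relations.sub_mem hA hlift

end Summit.KontsevichZagierPeriods.InverseLandau.TateFamilyKernel
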